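import Summits.QuantumAdvantage.QuantumAdvantage.Theorems.LinnikCubicClassGroupsDegreeOnePrimesEscapeUpperShadowAddLocal
import Summits.QuantumAdvantage.QuantumAdvantage.Theorems.LinnikCubicClassGroupsDegreeOnePrimesEscapeLowerShadowAddLocal
import Summits.QuantumAdvantage.QuantumAdvantage.Theorems.LinnikCubicClassGroupsDegreeOnePrimesEscapeCompositionLocal
import Summits.QuantumAdvantage.QuantumAdvantage.Theorems.LinnikCubicClassGroupsDegreeOnePrimesEscapeClassPNTAllFields
import Summits.QuantumAdvantage.QuantumAdvantage.Theorems.LinnikCubicClassGroupsDegreeOnePrimesEscape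
import HarnessLib

/-!
# Crux `DegreeOnePrimesEscape` (stmt-QuantumAdvantage-11543) VIA THE ADDITIVE CLASS PNT — unconditional

Route `LinnikCubicClassGroups`, line `dedekind-s3-collision`; cell B2b-1 (linnik-cubic), PART B (the brief's
literal path "ClassPNTAdditive → `degreeOnePrimesEscape_of_additive` → DegreeOnePrimesEscape / CubicEscape").
HONEST FRAMING: the crux is ALREADY CLOSED (p176956, line `subgroup-orthogonality-escape`); this file is a
second, independent kernel-checked derivation — value = theorem / bookkeeping, NOT summit progress.

`…DegreeOnePrimesEscape.lean` proves the crux from the additive class PNT dichotomy with ONE constant for all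
degrees (`degreeOnePrimesEscape_of_additive`, CONDITIONAL on the registered uniform stub
`stub_classPNTAdditive`, still open in that form).  The tree proves the dichotomy DEGREE-LOCALLY and
unconditionally (`classPNTAdditive_allFields n hn`, p179022: PART A's log-free density chain + PART B's residue
bound for every field).  Since the crux is itself degree-local, the uniformity is not needed:

* `degreeOnePrimesEscape_of_additiveLocal` — the crux BY NAME from the degree-local additive dichotomy
  `∀ n > 1, ∃ c₁(n) > 0, ∀ K of degree n, …` (composition `shadowsComposition_local` of
  `upperShadow_of_additive_local` and `lowerShadow_of_additive_local` with the proved Stark input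
  `starkInexplicit_holds`);
* an `example` of type `DegreeOnePrimesEscape` — the crux, UNCONDITIONALLY, by this route
  (`degreeOnePrimesEscape_of_additiveLocal (fun n hn => classPNTAdditive_allFields n hn)`; not a named
  theorem because it would restate the landed `degreeOnePrimesEscape_proof`).

Consequence for the ledger (planner's business, recorded here as evidence): the registered stub
`stub_classPNTAdditive` is stronger than anything the line consumes; its degree-local weakening is proved
(p179022) and suffices (this file).
-/

noncomputable section

open scoped NumberField nonZeroDivisors
open Literature.NumberTheory.LFunctions Literature.NumberTheory.LFunctions.NumberField

namespace Summit.QuantumAdvantage.QuantumAdvantage.Theorems.DegreeOnePrimesEscape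

/-- **The crux from the DEGREE-LOCAL additive class PNT dichotomy** (Stark's input is the proved
`starkInexplicit_holds`). -/
theorem degreeOnePrimesEscape_of_additiveLocal
    (hAdd : ∀ n : ℕ, 1 < n → ∃ c₁ : ℝ, 0 < c₁ ∧ ∀ (K : Type) [Field K] [NumberField K],
      Module.finrank ℚ K = n →
      ((∀ (C : ClassGroup (𝓞 K)) (x : ℝ), ThornerZaman.condQn K ^ c₁ ≤ x →
          |(primeIdealClassCount K C x : ℝ) - offsetLogIntegral x / NumberField.classNumber K| ≤
            offsetLogIntegral x / (32 * NumberField.classNumber K)) ∨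
        ∃ (χ₁ : ClassGroup (𝓞 K) →* ℂˣ) (β₁ : ℝ), χ₁ * χ₁ = 1 ∧
          1 - 1 / (8 * Real.log (ThornerZaman.condQn K)) < β₁ ∧ β₁ < 1 ∧
          classGroupLFunction K χ₁ β₁ = 0 ∧
          ∀ (C : ClassGroup (𝓞 K)) (x : ℝ), ThornerZaman.condQn K ^ c₁ ≤ x →
            |(primeIdealClassCount K C x : ℝ) -
                (offsetLogIntegral x - ((χ₁ C : ℂ)).re * offsetLogIntegral (x ^ β₁)) /
                  NumberField.classNumber K| ≤
              offsetLogIntegral x / (32 * NumberField.classNumber K))) :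
    Summit.QuantumAdvantage.QuantumAdvantage.Theses.LinnikCubicClassGroups.DegreeOnePrimesEscape :=
  shadowsComposition_local (fun n hn => upperShadow_of_additive_local n hn (hAdd n hn))
    (lowerShadow_of_additive_local hAdd starkInexplicit_holds)

/-- The unconditional composition, kernel-checked as an `example` (a named theorem of this type would
merely restate the landed `degreeOnePrimesEscape_proof`, which the dedup gate forbids): the crux via the
additive class PNT, with `classPNTAdditive_allFields` (p179022) as the degree-local input. -/
example : Summit.QuantumAdvantage.QuantumAdvantage.Theses.LinnikCubicClassGroups.DegreeOnePrimesEscape :=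
  degreeOnePrimesEscape_of_additiveLocal fun n hn => classPNTAdditive_allFields n hn

end Summit.QuantumAdvantage.QuantumAdvantage.Theorems.DegreeOnePrimesEscape

end
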